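/-
Copyright: statement-level skeleton of a published paper (lit-balaban cell, Phase-2 proof seat p10, gen 4). No proof claims
beyond what the kernel checks below.
-/
import Mathlib
import Literature.MathematicalPhysics.QuantumFieldTheory.BalabanImbrieJaffe1984to88.BIJ85Eq7113DerivationPart6

/-!
# `BalabanImbrieJaffe1984to88.BIJ85Thm711ConfigSpace` — T. Bałaban, J. Imbrie, A. Jaffe, *Renormalization of the Higgs model:
minimizers, propagators and the stability of mean field theory*, Commun. Math. Phys. **97** (1985) 299–329
[BalabanImbrieJaffe1985]: **Theorem 7.1.1 p. 321** *"There exists a constant c > 0, independent of k, such that c ≤ σ_k"* —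
**IN CONFIGURATION SPACE, for the CONCRETE operators on the tori** (∂^η = n·`curlC`, Q^{e*}_k = p27's `edgeAdjC`, Q_k = pub-balaban's
`B5Block118.QvOp`), variational form of (4.2.1): 2c(d)‖f‖² ≤ ‖∂^ηA − Q^{e*}_kf‖²_η for every two-form f and every A with Q_kA = 0,
odd block size n = 2M + 1, c(d) depending on the dimension only — PROVED

statement-level skeleton of published theorems with citation tags; proofs where landed; nothing here is a claim about
the Yang–Mills mass gap

CITATION HEADER (lean-in-tree rule).  Part of the lit-balaban TYPED SKELETON (HOME `run/shared/lean/pub/lit-balaban/`); WHAT IS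
REPRODUCED: the HEAD of SKELETON row **C1.Thm7.1.1** (`HOME/lit-balaban-r15/ROWS-C1.md`, fold owner r15, referee ref-5; r15 v1.26:
*"Head of C1.Thm7.1.1 stays typed until p27's dictionary (fibreEnergy ↔ energyC on lShifts) … compose the configuration-space
Thm711"*) in the variational form of (4.2.1) p. 310 / (7.1.12) p. 322 (½⟨f,σ_kf⟩ = the infimum over the constrained A of
½‖∂A − Q^{e*}_kf‖² up to the normalisation of (4.2.1); the passage from the variational bound to the Gaussian-integral definition
(4.2.1) of σ_k and the axial gauge is row C1.Eq4.2.1-4.2.2's and is NOT restated here).  Kind «assembly»: NOTHING new is computed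
in this file — it is p27 g5's `BIJ85Eq7112FibreEnergy.thm711_config_of_fibre` argument VERBATIM (energy split over the dual momenta
`energy_eq_sum_fibreEnergy`, Plancherel `sum_norm_sq_eq_sum_norm_sq_dftC`, constraint split `QvOp_eq_zero_iff`,
`fibreConstraint_smul_iff`) with its uniform fibrewise hypothesis `hfib` SUPPLIED by this seat's `BIJ85Eq7113DerivationPart6.hfib_twoForm`
(the (7.1.13) derivation `BIJ85Eq7113Derivation`…`Part3`, Prop. 7.1.2 at every momentum of the closed cube `…Part5`, the
offset ↔ shift dictionary `…Part6`), applied to the antisymmetric transforms f̂(q,·) (`dftC_antisymm`).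
WHAT IS PROVED (zero `sorry`, standard axioms): `dftC_antisymm`; **`thm711_configSpace (hd : 0 < d) (M : ℕ) {N} (f) (hf :
antisymmetric) (A) (hA : QvOp (2M+1) N *ᵥ A = 0) : 2·c711 d·Σ_a‖f a‖² ≤ ((2M+1)^d)⁻¹·Σ_b‖((2M+1)•(curlC (fine (2M+1) N) *ᵥ A) −
edgeAdjC (2M+1) N *ᵥ f) b‖²`**; `thm711_configSpace_exists`: ∃ c > 0 (= 2·c711 d) uniform in the block size n = 2M + 1 (every k:
n = L^k with L odd), the torus N, f and A.
NOT CLAIMED: even block sizes (r15's symmetric shift range `lShifts` is a complete residue system only for odd n); plaquette fields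
with a symmetric part (σ_k acts on two-forms); the operator inequality c ≤ σ_k for the Gaussian-integral σ_k of (4.2.2) as an
operator on the unit torus (row C1.Eq4.2.1-4.2.2 / p27's `BIJ85Eq712Plancherel` transport), beyond the variational form above.
v1.2 (MERGE by seat p27 gen 5, file history): p254178 (p10 g4, ACCEPTED 2111ac4d05ce) landed this file first; p27's crossed filing
p254470 (same path, written before p254178 was visible; ACCEPTED ec48d8af2b9d) replaced it with an equivalent text (same three
declaration names, `thm711_configSpace` with a different binder order); THIS version restores p254178's three declarations VERBATIM
(decls of record, signatures as announced to r15) and appends p27's generic split lemma `thm711_config_of_fibre_twoForm` (§2: ANY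
block size `n`, ANY constant `c₀` — the two-form variant of `BIJ85Eq7112FibreEnergy.thm711_config_of_fibre`, the form an even-`n`
fibrewise bound would feed).
Unit `lit-balaban-p10` (gen 4), HOME as above; configuration-space side by `lit-balaban-p27` (gen 4–5).
-/

namespace Literature.MathematicalPhysics.QuantumFieldTheory.BalabanImbrieJaffe1984to88.BIJ85Thm711ConfigSpace

open scoped BigOperators Real ComplexConjugate Matrix
open Complex Finset
open Literature.MathematicalPhysics.QuantumFieldTheory.BalabanImbrieJaffe1984to88.BIJ85SigmaClosedCube
open Literature.MathematicalPhysics.QuantumFieldTheory.BalabanImbrieJaffe1984to88.BIJ85Eq7113DerivationPart6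
open Literature.MathematicalPhysics.QuantumFieldTheory.BalabanImbrieJaffe1984to88.BIJ85Eq712Plancherel
open Literature.MathematicalPhysics.QuantumFieldTheory.BalabanImbrieJaffe1984to88.BIJ85Eq715ConfigSymbols
open Literature.MathematicalPhysics.QuantumFieldTheory.BalabanImbrieJaffe1984to88.BIJ85Eq7111EdgeAdjoint
open Literature.MathematicalPhysics.QuantumFieldTheory.BalabanImbrieJaffe1984to88.BIJ85Eq7112FibreEnergy
open Literature.MathematicalPhysics.QuantumFieldTheory.Balaban1983to89
open Literature.MathematicalPhysics.QuantumFieldTheory.Balaban1983to89.B5Prop11Plancherel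
open Literature.MathematicalPhysics.QuantumFieldTheory.Balaban1983to89.B5Block118

noncomputable section

variable {d : ℕ}

/-- The componentwise discrete Fourier transform preserves antisymmetry in the orientation index: for a plaquette field f with
f_{νμ} = −f_{μν}, also f̂_{νμ}(q) = −f̂_{μν}(q). [cite: BalabanImbrieJaffe1985, (7.1.2) p.321] -/
theorem dftC_antisymm {N : Fin d → ℕ} [∀ μ, NeZero (N μ)] {f : Tor N × (Fin d × Fin d) → ℂ}
    (hf : ∀ x μ ν, f (x, (ν, μ)) = -f (x, (μ, ν))) (q : Tor N) (μ ν : Fin d) :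
    (dftC N (Fin d × Fin d) *ᵥ f) (q, (ν, μ)) = -(dftC N (Fin d × Fin d) *ᵥ f) (q, (μ, ν)) := by
  rw [dftC_mulVec_apply, dftC_mulVec_apply, ← Finset.sum_neg_distrib]
  exact Finset.sum_congr rfl fun x _ => by rw [hf x μ ν, mul_neg]

/-- **THEOREM 7.1.1 IN CONFIGURATION SPACE (variational form, odd block size n = 2M + 1)**: for every dimension d ≥ 1, every
coarse torus Tor N, every ANTISYMMETRIC unit-lattice plaquette field f (a two-form: f_{νμ} = −f_{μν}) and every η-lattice bond field
A with Q_kA = 0 (pub-balaban's `B5Block118.QvOp`):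
  2c(d)·Σ_b|f(b)|² ≤ η^d Σ_x |(n·curl A − Q^{e*}_kf)(x)|² = ‖∂^ηA − Q^{e*}_kf‖²_η,
with c(d) = `c711 d` INDEPENDENT of k, n, N — the uniform lower bound of the Gaussian/variational problem (4.2.1) defining
½⟨f, σ_kf⟩ = inf over the constrained A (so c ≤ σ_k, Theorem 7.1.1, for the configuration-space σ_k of (4.2.2) on the torus in
the axial gauge).  ASSEMBLY: p27's `BIJ85Eq7112FibreEnergy.thm711_config_of_fibre` argument verbatim (`energy_eq_sum_fibreEnergy`,
Plancherel `sum_norm_sq_eq_sum_norm_sq_dftC`, `QvOp_eq_zero_iff`, `fibreConstraint_smul_iff`) with its hypothesis `hfib` supplied,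
fibre by fibre, by `BIJ85Eq7113DerivationPart6.hfib_twoForm` (this seat: (7.1.13) derivation + Prop. 7.1.2 at every momentum of the
closed cube) on the antisymmetric transforms f̂(q,·) (`dftC_antisymm`). [cite: BalabanImbrieJaffe1985, Thm. 7.1.1 p.321] -/
theorem thm711_configSpace (hd : 0 < d) (M : ℕ) {N : Fin d → ℕ} [∀ μ, NeZero (N μ)]
    (f : Tor N × (Fin d × Fin d) → ℂ) (hf : ∀ x μ ν, f (x, (ν, μ)) = -f (x, (μ, ν)))
    (A : Tor (fine (2 * M + 1) N) × Fin d → ℂ) (hA : QvOp (2 * M + 1) N *ᵥ A = 0) :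
    2 * c711 d * ∑ a, ‖f a‖ ^ 2 ≤ (((2 * M + 1 : ℕ) : ℝ) ^ d)⁻¹ *
      ∑ b, ‖(((2 * M + 1 : ℕ) : ℂ) • (curlC (fine (2 * M + 1) N) *ᵥ A) - edgeAdjC (2 * M + 1) N *ᵥ f) b‖ ^ 2 := by
  have hc : (cQ (2 * M + 1) N : ℂ) ≠ 0 := by
    have hn : (0 : ℝ) < ((2 * M + 1 : ℕ) : ℝ) ^ d := pow_pos (by positivity) d
    rw [cQ_eq]
    exact_mod_cast (inv_pos.mpr (Real.sqrt_pos.mpr hn)).ne'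
  rw [energy_eq_sum_fibreEnergy, sum_norm_sq_eq_sum_norm_sq_dftC N (Fin d × Fin d) f, Finset.mul_sum]
  refine Finset.sum_le_sum fun q _ => hfib_twoForm M hd q (fun μ ν => dftC_antisymm hf q μ ν) _ ?_
  rw [fibreConstraint_smul_iff (2 * M + 1) N q _ hc]
  exact (QvOp_eq_zero_iff (2 * M + 1) N A).mp hA q

/-- The same with the uniform constant packaged as in the printed statement *"There exists a constant c > 0, independent of k,
such that c ≤ σ_k"*: ∃ c > 0 (depending on d only) bounding EVERY block size n = 2M + 1, every torus and every constrained A.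
[cite: BalabanImbrieJaffe1985, Thm. 7.1.1 (7.1.1) p.321] -/
theorem thm711_configSpace_exists (hd : 0 < d) :
    ∃ c : ℝ, 0 < c ∧ ∀ (M : ℕ) (N : Fin d → ℕ) [∀ μ, NeZero (N μ)] (f : Tor N × (Fin d × Fin d) → ℂ),
      (∀ x μ ν, f (x, (ν, μ)) = -f (x, (μ, ν))) → ∀ (A : Tor (fine (2 * M + 1) N) × Fin d → ℂ),
      QvOp (2 * M + 1) N *ᵥ A = 0 →
      c * ∑ a, ‖f a‖ ^ 2 ≤ (((2 * M + 1 : ℕ) : ℝ) ^ d)⁻¹ *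
        ∑ b, ‖(((2 * M + 1 : ℕ) : ℂ) • (curlC (fine (2 * M + 1) N) *ᵥ A) - edgeAdjC (2 * M + 1) N *ᵥ f) b‖ ^ 2 :=
  ⟨2 * c711 d, by have := c711_pos hd; positivity, fun M N _ f hf A hA => thm711_configSpace hd M f hf A hA⟩

/-! ## §2 The generic split lemma (any block size `n`, any constant) — seat p27 gen 5 -/

/-- **The two-form variant of `BIJ85Eq7112FibreEnergy.thm711_config_of_fibre`** (any block size `n`, any constant `c₀`): a UNIFORM
fibrewise bound `c₀|φ|² ≤ E_{p′}(α, φ)` on constrained `α`, required for ANTISYMMETRIC `φ` only, gives `c₀Σ|f|² ≤ η^dΣ|∂^ηA − Q^{e*}_kf|²`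
for every antisymmetric `f` and every `A` with `Q_kA = 0` (the fibre `φ = f̂(p′)` of an antisymmetric `f` is antisymmetric,
`dftC_antisymm`); `thm711_configSpace` above is the case `n = 2M+1`, `c₀ = 2·c711 d` (p10's `hfib_twoForm`).
[cite: BalabanImbrieJaffe1985, (7.1.12) p.322] -/
theorem thm711_config_of_fibre_twoForm (n : ℕ) [NeZero n] {N : Fin d → ℕ} [∀ μ, NeZero (N μ)] {c₀ : ℝ}
    (hfib : ∀ (q : Tor N) (φ : Fin d × Fin d → ℂ), (∀ μ ν, φ (ν, μ) = -φ (μ, ν)) →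
      ∀ (α : (Fin d → Fin n) → Fin d → ℂ), FibreConstraint n N q α → c₀ * ∑ a, ‖φ a‖ ^ 2 ≤ fibreEnergy n N q α φ)
    (f : Tor N × (Fin d × Fin d) → ℂ) (hf : ∀ x μ ν, f (x, (ν, μ)) = -f (x, (μ, ν)))
    (A : Tor (fine n N) × Fin d → ℂ) (hA : QvOp n N *ᵥ A = 0) :
    c₀ * ∑ a, ‖f a‖ ^ 2 ≤ ((n : ℝ) ^ d)⁻¹ * ∑ b, ‖((n : ℂ) • (curlC (fine n N) *ᵥ A) - edgeAdjC n N *ᵥ f) b‖ ^ 2 := by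
  have hc : (cQ n N : ℂ) ≠ 0 := by
    have hn : (0 : ℝ) < (n : ℝ) ^ d := pow_pos (by exact_mod_cast Nat.pos_of_ne_zero (NeZero.ne n)) d
    rw [cQ_eq]
    exact_mod_cast (inv_pos.mpr (Real.sqrt_pos.mpr hn)).ne'
  rw [energy_eq_sum_fibreEnergy, sum_norm_sq_eq_sum_norm_sq_dftC N (Fin d × Fin d) f, Finset.mul_sum]
  refine Finset.sum_le_sum fun q _ => hfib q _ (fun μ ν => dftC_antisymm hf q μ ν) _ ?_
  rw [fibreConstraint_smul_iff n N q _ hc]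
  exact (QvOp_eq_zero_iff n N A).mp hA q

end

end Literature.MathematicalPhysics.QuantumFieldTheory.BalabanImbrieJaffe1984to88.BIJ85Thm711ConfigSpace
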